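import Mathlib
import Summits.Ventures.PercRepro2.ThreeTermInstanceHOB

/-!
# Three-terminal parts, V e: the core `S4C111` — partition table evaluated in the kernel, certified,
and row 2′TRI on the core plus the star for every type map on the star
(blind cell PercRepro2, night-3 g30, 2026-08-29; `proofs/NIGHT3-CERT.md` §39.8; GENERATED by
mining/night-3/g30/inst/mkinstance.py from the core specification — the pipeline of §39.6)

THE CORE `S4C111`: marks `l = 0` (`a₁`), `h = 1` (`a₂`), `o = 2`, `b = 3`, `a₃ = 4`; core edges (with
types) [(0, 2, 1), (2, 3, 1), (3, 1, 1)]; terminal triple (0, 1, 4).  The instance carries the three-terminal star at `u = 5`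
(edges `3, 4, 5` to the terminals); the part graph is the core plus the virtual edges.
Symmetric coefficients with a negative value: {}.
Certificate (certlp.py): mono (0, 0, 0) = 2; mono (0, 0, 2) = 6; mono (0, 0, 3) = 8; mono (0, 2, 2) = 4; mono (0, 2, 3) = 10; mono (0, 3, 3) = 6.

Own work; standard axioms (the table by `decide +kernel`).
-/

namespace Summit.Ventures.PercRepro2

open TypedStar Part ThreeTerm CovForm CovForm.OneTyped CovForm.TypedRed

namespace InstS4C111

/-! ## The instance -/

/-- The star instance. -/
def ends : Fin 6 → Sym2 (Fin 6) := ![s(0, 2), s(2, 3), s(3, 1), s(5, 0), s(5, 1), s(5, 4)]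

/-- The star's edges. -/
def S : Finset (Fin 6) := {3, 4, 5}

/-- The core's edges. -/
def F : Finset (Fin 6) := {0, 1, 2}

/-- The pinning (irrelevant: every edge is typed). -/
def z₀ : Config (Fin 6) := fun _ => false

/-- The type map of record (the star's types are free, see the end). -/
def τ₀ : Fin 6 → ℕ := ![1, 1, 1, 1, 1, 1]

/-- The part graph: the core plus the virtual edges (`u` isolated). -/
def pg : Fin 6 → Sym2 (Fin 6) := ![s(0, 2), s(2, 3), s(3, 1), s(0, 1), s(0, 4), s(1, 4)]

/-- `partEnds` of the instance is the part graph. -/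
lemma partEnds_eq : partEnds ends (↑S) 3 4 5 0 1 4 = pg := by
  funext e
  fin_cases e <;> rfl

/-- The star is a part: `S` is exactly the set of edges touching `u`. -/
lemma hS : ∀ e, e ∈ S ↔ e ∈ touches ends {5} := by
  intro e
  fin_cases e <;> simp [S, touches, ends]

/-! ## The states of the part graph, tabled -/

/-- The computable state (Mathlib's decidable `Reachable`). -/
def stC (ω : Config (Fin 6)) : St :=
  (decide (Conn pg ω 1 0), decide (Conn pg ω 0 2), decide (Conn pg ω 1 2), decide (Conn pg ω 0 3),
    decide (Conn pg ω 1 3), decide (Conn pg ω 0 4), decide (Conn pg ω 1 4))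

/-- The cell's state is the computable state. -/
lemma st_eq_stC (ω : Config (Fin 6)) : st pg 2 0 1 4 3 ω = stC ω := by
  unfold st stC
  refine Prod.ext ?_ (Prod.ext ?_ (Prod.ext ?_ (Prod.ext ?_ (Prod.ext ?_ (Prod.ext ?_ ?_))))) <;>
    exact decide_eq_decide.mpr Iff.rfl

/-- The configuration with bits `m`. -/
def cfgOf (m : Fin 64) : Config (Fin 6) := fun e => m.val.testBit e.val

/-- The bits of a configuration. -/
def enc (ω : Config (Fin 6)) : Fin 64 := Fin.ofNat 64 (∑ e : Fin 6, (ω e).toNat * 2 ^ (e : ℕ))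

/-- Configurations are bit vectors. -/
def cfgEquiv : Config (Fin 6) ≃ Fin 64 where
  toFun := enc
  invFun := cfgOf
  left_inv := by decide
  right_inv := by decide

/-- The `64` states, tabled. -/
def stTab : Fin 64 → St :=
  ![(false, false, false, false, false, false, false),
   (false, true, false, false, false, false, false),
   (false, false, false, false, false, false, false),
   (false, true, false, true, false, false, false),
   (false, false, false, false, true, false, false),
   (false, true, false, false, true, false, false),
   (false, false, true, false, true, false, false),
   (true, true, true, true, true, false, false),
   (true, false, false, false, false, false, false),
   (true, true, true, false, false, false, false),
   (true, false, false, false, false, false, false),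
   (true, true, true, true, true, false, false),
   (true, false, false, true, true, false, false),
   (true, true, true, true, true, false, false),
   (true, true, true, true, true, false, false),
   (true, true, true, true, true, false, false),
   (false, false, false, false, false, true, false),
   (false, true, false, false, false, true, false),
   (false, false, false, false, false, true, false),
   (false, true, false, true, false, true, false),
   (false, false, false, false, true, true, false),
   (false, true, false, false, true, true, false),
   (false, false, true, false, true, true, false),
   (true, true, true, true, true, true, true),
   (true, false, false, false, false, true, true),
   (true, true, true, false, false, true, true),
   (true, false, false, false, false, true, true),
   (true, true, true, true, true, true, true),
   (true, false, false, true, true, true, true),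
   (true, true, true, true, true, true, true),
   (true, true, true, true, true, true, true),
   (true, true, true, true, true, true, true),
   (false, false, false, false, false, false, true),
   (false, true, false, false, false, false, true),
   (false, false, false, false, false, false, true),
   (false, true, false, true, false, false, true),
   (false, false, false, false, true, false, true),
   (false, true, false, false, true, false, true),
   (false, false, true, false, true, false, true),
   (true, true, true, true, true, true, true),
   (true, false, false, false, false, true, true),
   (true, true, true, false, false, true, true),
   (true, false, false, false, false, true, true),
   (true, true, true, true, true, true, true),
   (true, false, false, true, true, true, true),
   (true, true, true, true, true, true, true),
   (true, true, true, true, true, true, true),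
   (true, true, true, true, true, true, true),
   (true, false, false, false, false, true, true),
   (true, true, true, false, false, true, true),
   (true, false, false, false, false, true, true),
   (true, true, true, true, true, true, true),
   (true, false, false, true, true, true, true),
   (true, true, true, true, true, true, true),
   (true, true, true, true, true, true, true),
   (true, true, true, true, true, true, true),
   (true, false, false, false, false, true, true),
   (true, true, true, false, false, true, true),
   (true, false, false, false, false, true, true),
   (true, true, true, true, true, true, true),
   (true, false, false, true, true, true, true),
   (true, true, true, true, true, true, true),
   (true, true, true, true, true, true, true),
   (true, true, true, true, true, true, true)]

set_option maxRecDepth 100000 in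
set_option maxHeartbeats 4000000 in
/-- The table is the state function (one kernel `decide`). -/
lemma stC_cfgOf : ∀ m : Fin 64, stC (cfgOf m) = stTab m := by decide +kernel

/-- The pin of pattern `p` on the star's edges. -/
def pin (p : Fin 5) : Config (Fin 6) := setOn S (cfg 3 4 5 (rep5 p)) z₀

/-- The bits of the configuration `cfgOf i` on the core's edges with the pin `p` on the star's. -/
def mix (i : Fin 64) (p : Fin 5) : Fin 64 :=
  ⟨i.val % 8 + 8 * (rep5 p).val, by
    have h1 := Nat.mod_lt i.val (show 0 < 8 by norm_num)
    have h2 := (rep5 p).isLt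
    omega⟩

/-- The pinned configuration is a bit vector. -/
lemma setOn_cfgOf : ∀ (i : Fin 64) (p : Fin 5), setOn F (cfgOf i) (pin p) = cfgOf (mix i p) := by
  decide

/-! ## The table -/

/-- The bit vectors of the core's edges, as configurations (the star's edges closed). -/
def cfgOfS (i : Fin 8) : Config (Fin 6) := cfgOf (Fin.castLE (by norm_num) i)

/-- A configuration supported on the core's edges is a core bit vector. -/
lemma suppOn_cfgOf_iff : ∀ i : Fin 64, SuppOn F (cfgOf i) ↔ i.val < 8 := by decide

/-- The typed-assignment condition on three core bit vectors. -/
abbrev cond (t : Fin 8 × Fin 8 × Fin 8) : Prop :=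
  (SuppOn F (cfgOfS t.1) ∧ SuppOn F (cfgOfS t.2.1) ∧ SuppOn F (cfgOfS t.2.2)) ∧
    ∀ e ∈ F, openCount (cfgOfS t.1) (cfgOfS t.2.1) (cfgOfS t.2.2) e = τ₀ e

/-- The typed assignments of the core's edges. -/
def Tset : Finset (Fin 8 × Fin 8 × Fin 8) := {(7, 0, 0), (3, 4, 0), (3, 0, 4), (5, 2, 0), (1, 6, 0), (1, 2, 4), (5, 0, 2), (1, 4, 2), (1, 0, 6), (6, 1, 0), (2, 5, 0), (2, 1, 4), (4, 3, 0), (0, 7, 0), (0, 3, 4), (4, 1, 2), (0, 5, 2), (0, 1, 6), (6, 0, 1), (2, 4, 1), (2, 0, 5), (4, 2, 1), (0, 6, 1), (0, 2, 5), (4, 0, 3), (0, 4, 3), (0, 0, 7)}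

set_option maxRecDepth 100000 in
/-- The typed assignments are exactly `Tset` (one kernel `decide` over the core bit-vector triples). -/
lemma filter_cond : (Finset.univ.filter cond) = Tset := by decide +kernel

/-- The bits of a core bit vector with the pin `p` on the star's edges. -/
def mixS (i : Fin 8) (p : Fin 5) : Fin 64 := mix (Fin.castLE (by norm_num) i) p

/-- The integer shadow of the table entry. -/
def entryZ (p q r : Fin 5) : ℤ :=
  ∑ t ∈ Tset, KB (stTab (mixS t.1 p)) (stTab (mixS t.2.1 q)) (stTab (mixS t.2.2 r))

/-- The embedding of core bit-vector triples. -/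
def castT (t : Fin 8 × Fin 8 × Fin 8) : Fin 64 × Fin 64 × Fin 64 :=
  (Fin.castLE (by norm_num) t.1, Fin.castLE (by norm_num) t.2.1, Fin.castLE (by norm_num) t.2.2)

/-- The embedding of triples is injective. -/
lemma castT_injective : Function.Injective castT := by
  rintro ⟨a, b, c⟩ ⟨a', b', c'⟩ h
  simp only [castT, Prod.mk.injEq] at h
  obtain ⟨h1, h2, h3⟩ := h
  rw [Fin.castLE_injective _ h1, Fin.castLE_injective _ h2, Fin.castLE_injective _ h3]

/-- **The partition table of the core is its integer shadow.** -/
theorem partTable5_eq_entryZ (p q r : Fin 5) :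
    partTable5 ends S 3 4 5 0 1 4 2 0 1 4 3 F z₀ τ₀ p q r = (entryZ p q r : ℚ) := by
  unfold partTable5 partTable
  rw [typedCount3_eq_sum_setOn, partEnds_eq, K3_eq_stKer]
  simp only [stKer, st_eq_stC]
  unfold entryZ
  rw [← filter_cond, Finset.sum_filter]
  push_cast
  rw [flatten3', ← (cfgEquiv.prodCongr (cfgEquiv.prodCongr cfgEquiv)).symm.sum_comp]
  -- the sum over all bit-vector triples is supported on the core bit vectors
  have hsupp : ∀ t : Fin 64 × Fin 64 × Fin 64, t ∉ Finset.univ.image castT →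
      (if (SuppOn F ((cfgEquiv.prodCongr (cfgEquiv.prodCongr cfgEquiv)).symm t).1 ∧
            SuppOn F ((cfgEquiv.prodCongr (cfgEquiv.prodCongr cfgEquiv)).symm t).2.1 ∧
            SuppOn F ((cfgEquiv.prodCongr (cfgEquiv.prodCongr cfgEquiv)).symm t).2.2) ∧
          ∀ e ∈ F, openCount ((cfgEquiv.prodCongr (cfgEquiv.prodCongr cfgEquiv)).symm t).1
            ((cfgEquiv.prodCongr (cfgEquiv.prodCongr cfgEquiv)).symm t).2.1
            ((cfgEquiv.prodCongr (cfgEquiv.prodCongr cfgEquiv)).symm t).2.2 e = τ₀ e then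
        ((KB (stC (setOn F ((cfgEquiv.prodCongr (cfgEquiv.prodCongr cfgEquiv)).symm t).1
            (setOn S (cfg 3 4 5 (rep5 p)) z₀)))
          (stC (setOn F ((cfgEquiv.prodCongr (cfgEquiv.prodCongr cfgEquiv)).symm t).2.1
            (setOn S (cfg 3 4 5 (rep5 q)) z₀)))
          (stC (setOn F ((cfgEquiv.prodCongr (cfgEquiv.prodCongr cfgEquiv)).symm t).2.2
            (setOn S (cfg 3 4 5 (rep5 r)) z₀))) : ℤ) : ℚ) else 0) = 0 := by
    intro t ht
    rw [if_neg]
    rintro ⟨⟨h1, h2, h3⟩, -⟩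
    apply ht
    simp only [Equiv.prodCongr_symm, Equiv.prodCongr_apply, Prod.map, cfgEquiv, Equiv.coe_fn_symm_mk] at h1 h2 h3
    rw [suppOn_cfgOf_iff] at h1 h2 h3
    rw [Finset.mem_image]
    exact ⟨(⟨t.1.val, h1⟩, ⟨t.2.1.val, h2⟩, ⟨t.2.2.val, h3⟩), Finset.mem_univ _, by
      simp only [castT]; rfl⟩
  rw [← Finset.sum_subset (Finset.subset_univ _) (fun t _ ht => hsupp t ht),
    Finset.sum_image (fun a _ b _ h => castT_injective h)]
  refine Finset.sum_congr rfl fun t _ => ?_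
  simp only [castT, Equiv.prodCongr_symm, Equiv.prodCongr_apply, Prod.map, cfgEquiv, Equiv.coe_fn_symm_mk]
  have e1 : setOn F (cfgOf (Fin.castLE (by norm_num) t.1)) (setOn S (cfg 3 4 5 (rep5 p)) z₀) =
      cfgOf (mixS t.1 p) := setOn_cfgOf _ p
  have e2 : setOn F (cfgOf (Fin.castLE (by norm_num) t.2.1)) (setOn S (cfg 3 4 5 (rep5 q)) z₀) =
      cfgOf (mixS t.2.1 q) := setOn_cfgOf _ q
  have e3 : setOn F (cfgOf (Fin.castLE (by norm_num) t.2.2)) (setOn S (cfg 3 4 5 (rep5 r)) z₀) =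
      cfgOf (mixS t.2.2 r) := setOn_cfgOf _ r
  show (if (SuppOn F (cfgOfS t.1) ∧ SuppOn F (cfgOfS t.2.1) ∧ SuppOn F (cfgOfS t.2.2)) ∧
      ∀ e ∈ F, openCount (cfgOfS t.1) (cfgOfS t.2.1) (cfgOfS t.2.2) e = τ₀ e then _ else 0) = _
  split_ifs
  · rw [e1, e2, e3, stC_cfgOf, stC_cfgOf, stC_cfgOf]
  · rfl

/-- The table (rows `p`, columns `q`, depth `r`). -/
def tbl5 : Fin 5 → Fin 5 → Fin 5 → ℤ :=
  ![![![2, 0, 4, 6, 0], ![0, 0, 0, 0, 0], ![-1, 0, 7, 3, 0], ![-1, 0, 7, 3, 0], ![0, 0, 0, 0, 0]],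
  ![![0, 0, 0, 0, 0], ![0, 0, 0, 0, 0], ![0, 0, 0, 0, 0], ![0, 0, 0, 0, 0], ![0, 0, 0, 0, 0]],
  ![![3, 0, -3, 3, 0], ![0, 0, 0, 0, 0], ![0, 0, 0, 0, 0], ![0, 0, 0, 0, 0], ![0, 0, 0, 0, 0]],
  ![![3, 0, -3, 3, 0], ![0, 0, 0, 0, 0], ![0, 0, 0, 0, 0], ![0, 0, 0, 0, 0], ![0, 0, 0, 0, 0]],
  ![![0, 0, 0, 0, 0], ![0, 0, 0, 0, 0], ![0, 0, 0, 0, 0], ![0, 0, 0, 0, 0], ![0, 0, 0, 0, 0]]]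

set_option maxRecDepth 100000 in
set_option maxHeartbeats 4000000 in
/-- **The `125` entries, by one kernel `decide`.** -/
theorem entryZ_eq : ∀ p q r : Fin 5, entryZ p q r = tbl5 p q r := by decide +kernel

/-- **The partition table of the core is `tbl5`.** -/
theorem partTable5_eq (p q r : Fin 5) :
    partTable5 ends S 3 4 5 0 1 4 2 0 1 4 3 F z₀ τ₀ p q r = (tbl5 p q r : ℚ) := by
  rw [partTable5_eq_entryZ, entryZ_eq]

/-! ## The certificate and the theorem (the coefficient-array method of ThreeTermInstanceHOB.lean) -/

/-- The bilinear coefficients of the nine homogenised Harris slacks. -/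
def H : Fin 9 → Fin 5 → Fin 5 → ℤ :=
  ![![![0, 0, 0, 0, 1], ![0, 0, -1, 0, 0], ![0, 0, 0, 0, 0], ![0, 0, 0, 0, 1], ![0, 0, 0, 0, 0]],
    ![![0, 0, 0, 0, 1], ![0, 0, 0, -1, 0], ![0, 0, 0, 0, 1], ![0, 0, 0, 0, 0], ![0, 0, 0, 0, 0]],
    ![![0, 0, 0, 0, 1], ![0, 0, 0, 0, 1], ![0, 0, 0, -1, 0], ![0, 0, 0, 0, 0], ![0, 0, 0, 0, 0]],
    ![![0, 0, 0, 0, 1], ![0, 0, -1, -1, 0], ![0, 0, 0, 0, 0], ![0, 0, 0, 0, 0], ![0, 0, 0, 0, 0]],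
    ![![0, 0, 0, 0, 1], ![0, 0, -1, 0, 0], ![0, 0, 0, -1, 0], ![0, 0, 0, 0, 0], ![0, 0, 0, 0, 0]],
    ![![0, 0, 0, 0, 1], ![0, 0, 0, -1, 0], ![0, 0, 0, -1, 0], ![0, 0, 0, 0, 0], ![0, 0, 0, 0, 0]],
    ![![0, 1, 0, 0, 1], ![0, 0, 0, 0, 0], ![0, 0, 0, -1, 0], ![0, 0, 0, 0, 0], ![0, 0, 0, 0, 0]],
    ![![0, 0, 1, 0, 1], ![0, 0, 0, -1, 0], ![0, 0, 0, 0, 0], ![0, 0, 0, 0, 0], ![0, 0, 0, 0, 0]],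
    ![![0, 0, 0, 1, 1], ![0, 0, -1, 0, 0], ![0, 0, 0, 0, 0], ![0, 0, 0, 0, 0], ![0, 0, 0, 0, 0]]]

/-- `H s` is the slack `hslack s`. -/
lemma H_sum (s : Fin 9) (μ : Fin 5 → ℚ) :
    (∑ q, ∑ r, (H s q r : ℚ) * (μ q * μ r)) = hslack s μ := by
  fin_cases s <;> simp [Fin.sum_univ_five, H, hslack] <;> ring

/-- The monomial multipliers of the certificate. -/
def lmZ : Fin 5 → Fin 5 → Fin 5 → ℤ :=
  ![![![2, 0, 6, 8, 0], ![0, 0, 0, 0, 0], ![0, 0, 4, 10, 0], ![0, 0, 0, 6, 0], ![0, 0, 0, 0, 0]],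
    ![![0, 0, 0, 0, 0], ![0, 0, 0, 0, 0], ![0, 0, 0, 0, 0], ![0, 0, 0, 0, 0], ![0, 0, 0, 0, 0]],
    ![![0, 0, 0, 0, 0], ![0, 0, 0, 0, 0], ![0, 0, 0, 0, 0], ![0, 0, 0, 0, 0], ![0, 0, 0, 0, 0]],
    ![![0, 0, 0, 0, 0], ![0, 0, 0, 0, 0], ![0, 0, 0, 0, 0], ![0, 0, 0, 0, 0], ![0, 0, 0, 0, 0]],
    ![![0, 0, 0, 0, 0], ![0, 0, 0, 0, 0], ![0, 0, 0, 0, 0], ![0, 0, 0, 0, 0], ![0, 0, 0, 0, 0]]]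

/-- The Harris multipliers of the certificate (`μ_i · hslack s`). -/
def lhZ : Fin 5 → Fin 9 → ℤ :=
  ![![0, 0, 0, 0, 0, 0, 0, 0, 0],
    ![0, 0, 0, 0, 0, 0, 0, 0, 0],
    ![0, 0, 0, 0, 0, 0, 0, 0, 0],
    ![0, 0, 0, 0, 0, 0, 0, 0, 0],
    ![0, 0, 0, 0, 0, 0, 0, 0, 0]]

/-- The generator array: `Σ_s lhZ p s · H s q r`. -/
def genZ (p q r : Fin 5) : ℤ := ∑ s : Fin 9, lhZ p s * H s q r

/-- Moving the innermost sum outermost (two swaps). -/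
lemma sum_comm3 (f : Fin 5 → Fin 5 → Fin 9 → ℚ) :
    (∑ q, ∑ r, ∑ s, f q r s) = ∑ s, ∑ q, ∑ r, f q r s :=
  calc (∑ q, ∑ r, ∑ s, f q r s) = ∑ q, ∑ s, ∑ r, f q r s :=
        Finset.sum_congr rfl (fun _ _ => Finset.sum_comm)
    _ = ∑ s, ∑ q, ∑ r, f q r s := Finset.sum_comm

/-- The cubic form of the generator array is the Harris part of the certificate. -/
lemma cubicZ_genZ (μ : Fin 5 → ℚ) :
    InstHOB.cubicZ genZ μ = ∑ p, ∑ s : Fin 9, (lhZ p s : ℚ) * (μ p * hslack s μ) := by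
  unfold InstHOB.cubicZ genZ
  refine Finset.sum_congr rfl fun p _ => ?_
  have step : ∀ q r : Fin 5, ((∑ s : Fin 9, lhZ p s * H s q r : ℤ) : ℚ) * (μ p * μ q * μ r) =
      ∑ s : Fin 9, (lhZ p s : ℚ) * (H s q r : ℚ) * (μ p * μ q * μ r) := by
    intro q r
    push_cast
    rw [Finset.sum_mul]
  refine Eq.trans (Finset.sum_congr rfl fun q _ => Finset.sum_congr rfl fun r _ => step q r) ?_
  rw [sum_comm3]
  refine Finset.sum_congr rfl fun s _ => ?_
  rw [← H_sum s μ, Finset.mul_sum, Finset.mul_sum]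
  refine Finset.sum_congr rfl fun q _ => ?_
  rw [Finset.mul_sum, Finset.mul_sum]
  refine Finset.sum_congr rfl fun r _ => ?_
  ring

set_option maxRecDepth 100000 in
/-- **The certificate identity on the symmetrised coefficients** (one kernel `decide` over `ℤ`). -/
lemma sym_eq : ∀ p q r : Fin 5,
    InstHOB.symZ tbl5 p q r = InstHOB.symZ (fun p q r => lmZ p q r + genZ p q r) p q r := by
  decide +kernel

/-- The monomial multipliers are nonnegative. -/
lemma lmZ_nonneg : ∀ i j k : Fin 5, 0 ≤ lmZ i j k := by decide

/-- The Harris multipliers are nonnegative. -/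
lemma lhZ_nonneg : ∀ (i : Fin 5) (s : Fin 9), 0 ≤ lhZ i s := by decide

/-- The multipliers in the cone's format. -/
def lm : Fin 5 → Fin 5 → Fin 5 → ℚ := fun i j k => (lmZ i j k : ℚ)

/-- The Harris multipliers in the cone's format. -/
def lh : Fin 5 → Fin 9 → ℚ := fun i s => (lhZ i s : ℚ)

/-- **The five-world cubic of the table is in the Harris cone.** -/
theorem inCone_S4C111 :
    InCone (fun ν => ∑ p : Fin 5, ∑ q : Fin 5, ∑ r : Fin 5,
      partTable5 ends S 3 4 5 0 1 4 2 0 1 4 3 F z₀ τ₀ p q r * mono p q r ν) := by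
  refine ⟨lm, lh, ?_, ?_, ?_⟩
  · intro i j k
    unfold lm
    exact_mod_cast lmZ_nonneg i j k
  · intro i s
    unfold lh
    exact_mod_cast lhZ_nonneg i s
  · intro μ
    simp only [partTable5_eq]
    change InstHOB.cubicZ tbl5 μ = InstHOB.cubicZ lmZ μ + ∑ p, ∑ s : Fin 9, (lhZ p s : ℚ) * (μ p * hslack s μ)
    rw [← cubicZ_genZ, ← InstHOB.cubicZ_add]
    exact InstHOB.cubicZ_eq_of_symZ sym_eq μ

/-- **ROW 2′TRI ON THE CORE `S4C111` PLUS THE STAR, FOR EVERY TYPE MAP ON THE STAR.** -/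
theorem typedCount_nonneg_S4C111 (τ : Fin 6 → ℕ) (hτ : ∀ e ∈ F, τ e = τ₀ e) :
    0 ≤ typedCount (F ∪ S) z₀ τ (CovForm.K3 (R := ℚ) ends 2 0 1 4 3) := by
  have hW : IsPart ends {5} 0 1 4 :=
    isPart_star (ends := ends) (u := 5) (t₁ := 0) (t₂ := 1) (t₃ := 4) (e₁ := 3) (e₂ := 4) (e₃ := 5)
      rfl rfl rfl (by decide) (by decide) (by decide) hS
  refine typedCount_part_nonneg_of_inCone5' (ends := ends) (W := {5}) (t₁ := 0) (t₂ := 1) (t₃ := 4) hW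
    (S := S) hS (e₁ := 3) (e₂ := 4) (e₃ := 5) (by decide) (by decide) (by decide) (by decide) (by decide)
    (by decide) (o := 2) (a₁ := 0) (a₂ := 1) (a₃ := 4) (b := 3) (by simp) (by simp) (by simp) (by simp)
    (by simp) (F := F) (Finset.disjoint_left.2 (by decide)) z₀ τ ?_
  have : (fun ν => ∑ p : Fin 5, ∑ q : Fin 5, ∑ r : Fin 5,
      partTable5 ends S 3 4 5 0 1 4 2 0 1 4 3 F z₀ τ p q r * mono p q r ν) =
      (fun ν => ∑ p : Fin 5, ∑ q : Fin 5, ∑ r : Fin 5,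
      partTable5 ends S 3 4 5 0 1 4 2 0 1 4 3 F z₀ τ₀ p q r * mono p q r ν) := by
    funext ν
    simp only [partTable5_congr_τ ends S 3 4 5 0 1 4 2 0 1 4 3 F z₀ hτ]
  rw [this]
  exact inCone_S4C111

end InstS4C111

end Summit.Ventures.PercRepro2

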